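import Summits.QuantumFields.BalabanUV.Beta.FP.WardNormalisation

/-!
# `BalabanUV.Beta.FP.MarginalUniquenessWard` — road «FP» for binder row D1, leaf H2-G (vertex germ) of the horizontal route, RISK (R3) DISSOLVED (owner ruling R-FP-15;
# `HOME/b2b-balaban-beta-d1-p3/N7-PROOF.v2.md` §7, `H2-DESIGN.md` §2): UNIQUENESS OF THE MARGINAL CUBIC GAUGE VERTEX **WITHOUT AXIS-PERMUTATION INVARIANCE** —
# reflections + Bose antisymmetry + the tree-level WARD identity against an ISOTROPIC transverse quadratic germ already force `L = cQ · ymGerm`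

HONEST DEPENDENCY (page 1, mandatory): continuum YM on T⁴ ⇐ BetaPertH ∧ nine spine estimates (0/9 proved); BetaPertH ⇐ (D1) ∧ (D4) ∧ CAP+tail;
G-an2-4 gates asym, D1 and NE2/3/4.  HONEST FRAMING (cell contract, verbatim): «discharging `BetaPertH` makes Bałaban's UV stability UNCONDITIONAL —
a real constructive-QFT result; it is NOT the continuum limit and NOT the Clay problem.»  THIS MODULE DISCHARGES NOTHING of the wall: pure finite-dimensional
linear algebra over `ℝ` (Mathlib only) on the coefficient tables of `FP/MarginalUniqueness` (`CubicGerm`, `FlipInvariant`, `Anti12`, `Anti13`, `ymGerm`) and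
`FP/WardNormalisation` (`WardGerm`, `quadGerm`, `e`).  No `def`, no `def … : Prop`, nothing cited, 0 sorry; NOT D1, NOT BetaPertH, NOT continuum, NOT Clay.

ABSOLUTE RULE (cell charter, verbatim): «No internally-minted statement may enter as a cited fact. Every hypothesis is either kernel-proved in this package or a
verbatim quotation of a PUBLISHED theorem with page reference. The manuscript(s) under audit are NOT citable for their own disputed steps — they are the thing
under adjudication; programme-internal (2001/route/tribunal) claims are never citable.»

WHY.  `MarginalUniqueness.cubic_unique` assumes invariance under the FULL hyperoctahedral group (signed permutations).  an1-g31's exact toy (RESULT «W-PERM»,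
journal 2026-08-20T17:52Z) shows that for the road's ONE-contour averaging prescription the tree-level one-step effective action is π-invariant at order `B²` but NOT
at order `B³`: the axis-PERMUTATION half of the hypothesis is not available for the road's objects (reflections are).  THIS FILE removes it: the Ward identity against
the quadratic germ — which IS isotropic transverse for the perfect Laplacian (`PerfectSymbol166.W166lim_zero`: `W_∞(·;0) = 1`, `quadGerm cQ 0 0`) — does the work
the permutations did, pattern by pattern:
* `x`-pattern `(a,a,b,b)`: Ward at `(p,q) = (e_b, 0)` resp. `(0, e_b)`, indices `(a,a)`  ⟹ `L a a b b 0 = cQ`, `L a a b b 1 = −cQ`;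
* `(a,a,a,a)`: Ward at `(e_a, 0)`, `(0, e_a)`, indices `(a,a)` ⟹ `0` (the transverse germ has no `aa`-diagonal response to `e_a`);
* `z`-pattern `(a,b,b,a)`: `Anti13` from the `x`-pattern ⟹ `cQ`, `2cQ`;  `y`-pattern `(a,b,a,b)`: `Anti12` from the `z`-pattern ⟹ `−2cQ`, `−cQ`;
* every other pattern dies by ONE reflection (`eq_zero_of_flip`).
MAIN THEOREM **`cubic_eq_of_flip_bose_ward`**: `FlipInvariant L → Anti12 L → Anti13 L → WardGerm L (quadGerm cQ 0 0) → ∀ μ ν λ κ i, L μ ν λ κ i = cQ · ymGerm μ ν λ κ i`.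
(An exact rank computation of the owner — 512 unknowns, rank 512 — confirms that nothing weaker than `ymGerm` survives; scratch only.)  CONSEQUENCE for the H-route:
the vertex GERM of the perfect action needs only reflection covariance (tree letters), Bose antisymmetry (structure constants) and lattice gauge invariance (Ward) — NO
permutation row; risk (R3) of `N7-PROOF.v2.md` §7 is gone for the germ.
Provenance: road FP owner b2b-balaban-beta-d1-p3 gen 4 (prover-b2b-balaban-beta-d1-p3-g4-0), 2026-08-20.  [our object]/[folklore].
-/

namespace Summit.QuantumFields.BalabanUV.Beta.FP.MarginalUniquenessWard

open Finset
open scoped BigOperators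
open Summit.QuantumFields.BalabanUV.Beta.FP.MarginalUniqueness
open Summit.QuantumFields.BalabanUV.Beta.FP.WardNormalisation

variable {L : CubicGerm} {cQ : ℝ}

/-! ## §1 The Ward identity evaluated at unit test momenta -/

/-- [folklore] `nsq (e b) = 1`. -/
theorem nsq_e (b : Idx) : nsq (e b) = 1 := by
  unfold nsq e
  simp [Finset.sum_ite_eq', Finset.mem_univ]

/-- [folklore] The transverse quadratic germ at a unit momentum, diagonal entry off the momentum axis: `Q(e_b)_{aa} = cQ` for `a ≠ b`. -/
theorem quadGerm_e_offdiag {a b : Idx} (h : a ≠ b) : quadGerm cQ 0 0 (e b) a a = cQ := by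
  unfold quadGerm
  rw [nsq_e]
  simp [δ, e, h]

/-- [folklore] … and ON the momentum axis: `Q(e_a)_{aa} = 0` (transversality of the germ). -/
theorem quadGerm_e_diag (a : Idx) : quadGerm cQ 0 0 (e a) a a = 0 := by
  unfold quadGerm
  rw [nsq_e]
  simp [δ, e]

/-! ## §2 The pattern values from Ward + Bose (no permutations) -/

/-- [our object] `x₀`: `L a a b b 0 = cQ` for `a ≠ b` (Ward at `(e_b, 0)`, indices `(a,a)`). -/
theorem val_aabb0 (hW : WardGerm L (quadGerm cQ 0 0)) {a b : Idx} (h : a ≠ b) : L a a b b 0 = cQ := by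
  have h1 := hW (e b) (fun _ => 0) a a
  rw [quadGerm_e_offdiag h] at h1
  simp [e, quadGerm, nsq, δ, Finset.sum_ite_eq', Finset.mem_univ] at h1
  linarith

/-- [our object] `x₁`: `L a a b b 1 = −cQ` for `a ≠ b` (Ward at `(0, e_b)`, indices `(a,a)`). -/
theorem val_aabb1 (hW : WardGerm L (quadGerm cQ 0 0)) {a b : Idx} (h : a ≠ b) : L a a b b 1 = -cQ := by
  have h1 := hW (fun _ => 0) (e b) a a
  rw [quadGerm_e_offdiag h] at h1
  simp [e, quadGerm, nsq, δ, Finset.sum_ite_eq', Finset.mem_univ] at h1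
  linarith

/-- [our object] `w₀ = 0`: `L a a a a 0 = 0` (Ward at `(e_a, 0)`, indices `(a,a)`: the transverse germ does not respond). -/
theorem val_aaaa0 (hW : WardGerm L (quadGerm cQ 0 0)) (a : Idx) : L a a a a 0 = 0 := by
  have h1 := hW (e a) (fun _ => 0) a a
  rw [quadGerm_e_diag a] at h1
  simp [e, quadGerm, nsq, δ, Finset.sum_ite_eq', Finset.mem_univ] at h1
  linarith

/-- [our object] `w₁ = 0`: `L a a a a 1 = 0`. -/
theorem val_aaaa1 (hW : WardGerm L (quadGerm cQ 0 0)) (a : Idx) : L a a a a 1 = 0 := by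
  have h1 := hW (fun _ => 0) (e a) a a
  rw [quadGerm_e_diag a] at h1
  simp [e, quadGerm, nsq, δ, Finset.sum_ite_eq', Finset.mem_univ] at h1
  linarith

/-- [our object] `z₀`: `L a b b a 0 = cQ` for `a ≠ b` (`Anti13` on the `x`-pattern). -/
theorem val_abba0 (h13 : Anti13 L) (hW : WardGerm L (quadGerm cQ 0 0)) {a b : Idx} (h : a ≠ b) : L a b b a 0 = cQ := by
  have e1 : L a b b a 0 = L b b a a 0 := h13.1 b b a a
  rw [e1, val_aabb0 hW (Ne.symm h)]

/-- [our object] `y₁`: `L a b a b 1 = −cQ` for `a ≠ b` (`Anti12` on the `z`-pattern). -/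
theorem val_abab1 (h12 : Anti12 L) (h13 : Anti13 L) (hW : WardGerm L (quadGerm cQ 0 0)) {a b : Idx} (h : a ≠ b) : L a b a b 1 = -cQ := by
  have e1 : L b a a b 0 = -L a b a b 1 := h12.2 a b a b
  have e2 : L b a a b 0 = cQ := val_abba0 h13 hW (Ne.symm h)
  linarith

/-- [our object] `z₁`: `L a b b a 1 = 2·cQ` for `a ≠ b` (`Anti13`, second family, on the `x`-pattern). -/
theorem val_abba1 (h13 : Anti13 L) (hW : WardGerm L (quadGerm cQ 0 0)) {a b : Idx} (h : a ≠ b) : L a b b a 1 = 2 * cQ := by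
  have e1 : L a b b a 1 - L a b b a 0 = -L b b a a 1 := h13.2 b b a a
  rw [val_abba0 h13 hW h, val_aabb1 hW (Ne.symm h)] at e1
  linarith

/-- [our object] `y₀`: `L a b a b 0 = −2·cQ` for `a ≠ b` (`Anti12` on the `z`-pattern). -/
theorem val_abab0 (h12 : Anti12 L) (h13 : Anti13 L) (hW : WardGerm L (quadGerm cQ 0 0)) {a b : Idx} (h : a ≠ b) : L a b a b 0 = -(2 * cQ) := by
  have e1 : L b a a b 1 = -L a b a b 0 := h12.1 a b a b
  have e2 : L b a a b 1 = 2 * cQ := val_abba1 h13 hW (Ne.symm h)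
  linarith

/-! ## §3 THE UNIQUENESS THEOREM WITHOUT PERMUTATIONS -/

/-- [our object] **UNIQUENESS OF THE MARGINAL CUBIC GAUGE VERTEX FROM REFLECTIONS + BOSE + WARD (no axis permutations).**  A cubic germ that is invariant under
the four axis REFLECTIONS, Bose-antisymmetric (legs 1 ↔ 2, 1 ↔ 3; colour `f^{abc}` stripped) and satisfies the tree-level Ward identity against the isotropic
transverse quadratic germ `cQ·(|k|²δ − kk)` IS `cQ · ymGerm`. -/
theorem cubic_eq_of_flip_bose_ward (hF : FlipInvariant L) (h12 : Anti12 L) (h13 : Anti13 L) (hW : WardGerm L (quadGerm cQ 0 0))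
    (μ ν lam κ : Idx) (i : Fin 2) : L μ ν lam κ i = cQ * ymGerm μ ν lam κ i := by
  by_cases hmn : μ = ν
  · subst hmn
    by_cases hlk : lam = κ
    · subst hlk
      by_cases hml : μ = lam
      · subst hml
        rw [ymGerm_aaaa, mul_zero]
        fin_cases i
        · exact val_aaaa0 hW μ
        · exact val_aaaa1 hW μ
      · rw [ymGerm_aabb hml]
        fin_cases i
        · simp [val_aabb0 hW hml]
        · simp [val_aabb1 hW hml]
    · by_cases hml : μ = lam
      · subst hml
        rw [eq_zero_of_flip hF κ i (by rw [rs_of_ne hlk, rs_self]; norm_num), ymGerm_aaab hlk, mul_zero]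
      · rw [eq_zero_of_flip hF lam i (by rw [rs_of_ne hml, rs_self, rs_of_ne (Ne.symm hlk)]; norm_num),
          ymGerm_aabc hml hlk, mul_zero]
  · by_cases hml : μ = lam
    · subst hml
      by_cases hnk : ν = κ
      · subst hnk
        rw [ymGerm_abab hmn]
        fin_cases i <;> simp <;> linarith [val_abab0 h12 h13 hW hmn, val_abab1 h12 h13 hW hmn]
      · rw [eq_zero_of_flip hF ν i (by rw [rs_of_ne hmn, rs_self, rs_of_ne (Ne.symm hnk)]; norm_num),
          ymGerm_abac hmn hnk, mul_zero]
    · by_cases hmk : μ = κ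
      · subst hmk
        by_cases hnl : ν = lam
        · subst hnl
          rw [ymGerm_abba hmn]
          fin_cases i <;> simp <;> linarith [val_abba0 h13 hW hmn, val_abba1 h13 hW hmn]
        · rw [eq_zero_of_flip hF ν i (by rw [rs_of_ne hmn, rs_self, rs_of_ne (Ne.symm hnl)]; norm_num),
            ymGerm_abca hmn hnl hml, mul_zero]
      · rw [eq_zero_of_flip hF μ i (by rw [rs_self, rs_of_ne (Ne.symm hmn), rs_of_ne (Ne.symm hml), rs_of_ne (Ne.symm hmk)]; norm_num),
          ymGerm_abcd hmn hml hmk, mul_zero]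

/-- [our object] **COROLLARY (normalised form)**: with the CANONICAL quadratic germ (`cQ = 1`, the perfect Laplacian's by `PerfectSymbol166.W166lim_zero`) the cubic germ
IS the Yang–Mills germ. -/
theorem cubic_eq_ym_of_flip_bose_ward (hF : FlipInvariant L) (h12 : Anti12 L) (h13 : Anti13 L) (hW : WardGerm L (quadGerm 1 0 0)) :
    L = ymGerm := by
  funext μ ν lam κ i
  rw [cubic_eq_of_flip_bose_ward hF h12 h13 hW μ ν lam κ i, one_mul]

/-- [our object] COROLLARY: the hypercubic-but-not-`O(4)` invariant (all four indices equal) has coefficient zero — now from Ward, without permutations. -/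
theorem all_equal_coeff_eq_zero_of_ward (hW : WardGerm L (quadGerm cQ 0 0)) (μ : Idx) (i : Fin 2) : L μ μ μ μ i = 0 := by
  fin_cases i
  · exact val_aaaa0 hW μ
  · exact val_aaaa1 hW μ

end Summit.QuantumFields.BalabanUV.Beta.FP.MarginalUniquenessWard
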